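import Summits.FinalStateConjecture.FinalStateConjecture.Theses.StarvedNecks
import Literature.Geometry.Lorentzian.TameGenericityDiagonal
import Literature.Geometry.Lorentzian.TameGenericityLocal
import HarnessLib

/-!
# Sketch — crux-ideate stmt-FinalStateConjecture-17575 (`StarvedNecks.HonestFixedRadiusSettlingT` = G′ = T),
# ideator 1, round 1: first lemmas of the three cards

* §0  named copies of the crux's predicates; `T` (the crux, ζ/δ-equal to the route decl — `T_iff`), `T0`
      (= `RetypeKitC5.HonestFixedRadiusSettlingT`, the crux WITHOUT the distinct-velocity conjunct);
* §A  card `soft-brooms`: `FarClean`, `TameSoftBroom`, `CleanCoreT`, and the reduction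
      `T_of_softBroom_of_cleanCore` (PROVED);
* §B  card `late-pair-kick`: `ParabolicCure` and the reduction `T_of_T0_of_parabolicCure` (PROVED, by the
      landed composition-along-curves lemma `isTameChristodoulouGeneric_of_relative'`);
* §C  card `no-hidden-infinity`: escaping rays, the chart-free domain of outer communications
      `docIntrinsic`, `NoHiddenInfinity`, the adapter `raysStayInClosure_of_noHiddenInfinity` (PROVED) and the
      split reduction `T_of_Tsplit` (PROVED).

Nothing here is analysis: the three physics statements (`CleanCoreT`, `ParabolicCure`, `NoHiddenInfinity` inside
`PTsplit`) are typed, not proved. Everything elaborates against the tree (`lean check` rc 0, 0 sorries intended).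
-/

noncomputable section

open Literature.Geometry.Lorentzian
open scoped Manifold ContDiff ENNReal Topology
open Filter Set Function

namespace Summit.FinalStateConjecture.FinalStateConjecture.Cruxes.HonestFixedRadiusSettlingT.Ideator1

set_option linter.dupNamespace false

/-! ### §0 Verbatim copies of the crux's let-bound predicates -/

/-- `HonestCore d R₀` — verbatim the let-bound `Hc` of item 17575. -/
def HonestCore (𝓢 : Spacetime.{0} 4) (O : Set 𝓢.carrier) (k : ℕ) (d : FinalStateDecomposition 𝓢 O k)
    (R₀ : ℝ) : Prop :=
  let B := d.background; let t := fun i ↦ (B i).time; let r := fun i ↦ (B i).radius; let Ψ := d.chart;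
  (∀ i, Kerr.IsSubextremal (d.mass i) (d.spin i) ∧ 100 * d.mass i ≤ R₀ ∧
      0 < ((d.motion i).1 : E4 ≃L[ℝ] E4) (E4.basisVector 0) 0) ∧
  (∀ i (ϱ τ₂ : ℝ), R₀ ≤ ϱ → d.τ₀ < τ₂ →
      Ψ i '' {x | d.τ₀ < t i x.1 ∧ t i x.1 < τ₂ ∧ r i x.1 < ϱ} ⊆
        𝓢.metric.causalPast 𝓢.timeOrientation (Ψ i '' (B i).truncTimeSlab ϱ τ₂)) ∧
  (∀ i (τ' : ℝ) (ϱ : ℝ → ℝ), Continuous ϱ → d.τ₀ < τ' →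
      let A := Ψ i '' {x | τ' ≤ t i x.1 ∧ r i x.1 ≤ ϱ (t i x.1)}; closure A ∩ O ⊆ A) ∧
  (∀ y : d.flatDomain, d.τ₀ < y.1 0 →
      𝓢.timeOrientation.IsFutureDirected (mfderiv 𝓘(ℝ, E4) (𝓡 4) d.flatChart y (E4.basisVector 0)))

/-- `HonestFar d R₀` — verbatim the let-bound `Hf` of item 17575. -/
def HonestFar (𝓢 : Spacetime.{0} 4) (O : Set 𝓢.carrier) (k : ℕ) (d : FinalStateDecomposition 𝓢 O k)
    (R₀ : ℝ) : Prop :=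
  let B := d.background; let t := fun i ↦ (B i).time; let r := fun i ↦ (B i).radius; let Φ := d.flatChart;
  (∀ τ₂ : ℝ, d.τ₀ < τ₂ → Φ '' {y | d.τ₀ < y.1 0 ∧ y.1 0 < τ₂} ⊆
      𝓢.metric.causalPast 𝓢.timeOrientation (Φ '' (Minkowski.backgroundOn d.flatDomain).timeSlab τ₂)) ∧
  (∀ τ' : ℝ, d.τ₀ < τ' →
      closure (Φ '' {y | τ' ≤ y.1 0 ∧ ∀ i, d.excision i (y.1 0) + 1 ≤ r i y.1}) ⊆ Φ '' {y | τ' ≤ y.1 0}) ∧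
  (∀ i, ∃ T : ℝ, supCkENorm (Subtype.val '' {x : (B i).domain | T ≤ t i x.1 ∧ R₀ ≤ r i x.1 ∧
      ∀ j, j ≠ i → r i x.1 ≤ r j x.1}) 0 (𝓢.deviationExtend (B i) (d.chart i)) ≤
        ENNReal.ofReal (1 / (10 * ‖(((d.motion i).1 : E4 ≃L[ℝ] E4) : E4 →L[ℝ] E4)‖ ^ 2)))

/-- The distinct-velocity conjunct of item 17575: the holes' asymptotic four-velocities `Λᵢ e₀` are
pairwise distinct (no comoving / parabolic-threshold pair). -/
def DistinctVelocities {𝓢 : Spacetime.{0} 4} {O : Set 𝓢.carrier} {k : ℕ}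
    (d : FinalStateDecomposition 𝓢 O k) : Prop :=
  ∀ i j : Fin d.N, i ≠ j →
    ((d.motion i).1 : E4 ≃L[ℝ] E4) (E4.basisVector 0) ≠ ((d.motion j).1 : E4 ≃L[ℝ] E4) (E4.basisVector 0)

section Pointwise

variable {X : Type} [TopologicalSpace X] [ChartedSpace E3 X] [IsManifold (𝓡 3) ∞ X] [ConnectedSpace X]

/-- `P_T`: the pointwise property whose TAME genericity item 17575 asserts. -/
def PT (D : InitialDataSet (𝓡 3) X) : Prop :=
  (∃ 𝒟 : VacuumCauchyDevelopment D, 𝒟.IsMaximal) ∧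
    ∀ 𝒟 : VacuumCauchyDevelopment D, 𝒟.IsMaximal →
      HasCompleteNullInfinity 𝒟.toCauchyDevelopment ∧
        ∃ (O : Set 𝒟.carrier) (d : FinalStateDecomposition 𝒟.toSpacetime O 4) (R₀ : ℝ),
          O = exteriorOf 𝒟.toCauchyDevelopment d.charted ∧
            RaysStayInClosure 𝒟.toCauchyDevelopment O ∧
              HonestCore 𝒟.toSpacetime O 4 d R₀ ∧ HonestFar 𝒟.toSpacetime O 4 d R₀ ∧
                DistinctVelocities d

/-- `P_T₀`: the same WITHOUT the distinct-velocity conjunct (the pointwise property of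
`RetypeKitC5.HonestFixedRadiusSettlingT`, leads c5–c7). -/
def PT0 (D : InitialDataSet (𝓡 3) X) : Prop :=
  (∃ 𝒟 : VacuumCauchyDevelopment D, 𝒟.IsMaximal) ∧
    ∀ 𝒟 : VacuumCauchyDevelopment D, 𝒟.IsMaximal →
      HasCompleteNullInfinity 𝒟.toCauchyDevelopment ∧
        ∃ (O : Set 𝒟.carrier) (d : FinalStateDecomposition 𝒟.toSpacetime O 4) (R₀ : ℝ),
          O = exteriorOf 𝒟.toCauchyDevelopment d.charted ∧
            RaysStayInClosure 𝒟.toCauchyDevelopment O ∧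
              HonestCore 𝒟.toSpacetime O 4 d R₀ ∧ HonestFar 𝒟.toSpacetime O 4 d R₀

omit [ConnectedSpace X] in
/-- `P_T ⇒ P_T₀` pointwise (forget the velocities). -/
theorem pt0_of_pt [ConnectedSpace X] {D : InitialDataSet (𝓡 3) X} (h : PT D) : PT0 D := by
  refine ⟨h.1, fun 𝒟 h𝒟 ↦ ⟨(h.2 𝒟 h𝒟).1, ?_⟩⟩
  obtain ⟨O, d, R₀, hO, hrays, hc, hf, -⟩ := (h.2 𝒟 h𝒟).2
  exact ⟨O, d, R₀, hO, hrays, hc, hf⟩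

end Pointwise

/-- **T** — the crux `StarvedNecks.HonestFixedRadiusSettlingT` (item 17575) with its let-bound predicates
ζ-reduced to the named copies (the same Prop: `T_iff`). -/
def T : Prop :=
  ∀ (X : Type) [TopologicalSpace X] [ChartedSpace E3 X] [IsManifold (𝓡 3) ∞ X] [T2Space X]
    [SecondCountableTopology X] [ConnectedSpace X],
    InitialDataSet.IsTameChristodoulouGeneric (admissibleVacuumData X) PT 1

/-- **T₀** — the crux without the distinct-velocity conjunct (`RetypeKitC5.HonestFixedRadiusSettlingT`). -/
def T0 : Prop :=
  ∀ (X : Type) [TopologicalSpace X] [ChartedSpace E3 X] [IsManifold (𝓡 3) ∞ X] [T2Space X]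
    [SecondCountableTopology X] [ConnectedSpace X],
    InitialDataSet.IsTameChristodoulouGeneric (admissibleVacuumData X) PT0 1

/-- `T` IS the route decl (ζ/δ): any reduction to `T` below is a reduction to item 17575 BY NAME. -/
theorem T_iff : T ↔ Theses.StarvedNecks.HonestFixedRadiusSettlingT := Iff.rfl

/-- The crux BY NAME from `T`. -/
theorem crux_of_T (h : T) : Theses.StarvedNecks.HonestFixedRadiusSettlingT := T_iff.mp h

/-- `T ⇒ T₀` (tame genericity is antitone in the exceptional set). -/
theorem T0_of_T (h : T) : T0 := fun X _ _ _ _ _ _ ↦ (h X).mono fun _ _ hP ↦ pt0_of_pt hP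

/-! ### §A Card `soft-brooms`: far-clean members along tame curves, and T relative to clean curves -/

section Broom

variable (X : Type) [TopologicalSpace X] [ChartedSpace E3 X] [IsManifold (𝓡 3) ∞ X]

/-- **Far-clean to order `m` on the end `e`**: `h = (1 + 2M/r) δ + o_m(r⁻¹)`, `k = o_{m-1}(r⁻²)` in the chart of `e`
— the Dafermos–Rodnianski class with `m` (resp. `m - 1`) weighted derivatives instead of `2` (resp. `1`);
`m = 2` is admissibility's own decay, `m ≥ 6` is what unweighted `C⁴` sups at fixed radius / on entire flat
slabs can see of the far field. (`AsymptoticFlatness.IsStronglyAsymptoticallyFlatWith e D M 1 2 m (m-1)`.) -/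
def FarClean (e : AFEnd X) (m : ℕ) (D : InitialDataSet (𝓡 3) X) : Prop :=
  ∃ M : ℝ, e.IsStronglyAsymptoticallyFlatWith D M 1 2 m (m - 1)

/-- **`TameSoftBroom X m`** (card `soft-brooms`, the elliptic support statement; printed-adjacent):
through EVERY admissible datum `d` passes a tame (on some end `e`), immersed, injective curve of ADMISSIBLE data,
`F 0 = d`, all of whose members off `0` are far-clean to order `m` on `e`.
Intended construction: `F c := Π (d + c·j + 𝔪_{Λ(c)} d − d|_{far})` — an interior compactly supported jet `j`
(immersion, injectivity), a variable-scale mollification `𝔪_Λ` of the free data beyond radius `Λ(c) = exp(c⁻²)`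
(cleaning; flat in `c` at `0`), and the projection `Π` onto the constraint manifold (Bartnik 2005 / Chruściel–Delay
2003: the constraint map is a submersion at every AF vacuum datum in weighted spaces, decaying KIDs being zero);
`wDist`-smallness is automatic inside the DR class, `M(c)` is continuous, `P_ADM = 0` is kept (`k̃ = o(r⁻²)`). -/
def TameSoftBroom (m : ℕ) : Prop :=
  ∀ d ∈ admissibleVacuumData X,
    ∃ (e : AFEnd X) (F : EuclideanSpace ℝ (Fin 1) → InitialDataSet (𝓡 3) X),
      InitialDataSet.IsTameDataFamily e 1 F ∧ InitialDataSet.IsImmersedAtZero 1 F ∧ F 0 = d ∧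
        Injective F ∧ (∀ c, F c ∈ admissibleVacuumData X) ∧ ∀ c ≠ 0, FarClean X e m (F c)

/-- **`CleanCoreT X m`** (card `soft-brooms`, the physics: `T` RELATIVE TO CLEAN CURVES): every tame curve of
admissible data on an end `e` whose members off `0` are far-clean to order `m` on `e` (the curve immersed and
injective, or constant) can be re-witnessed through the same base datum by a tame, injective, immersed curve of
admissible data (on some end) whose members off `0` satisfy `P_T`.  Shape = the hypothesis `hrel` of
`isTameChristodoulouGeneric_of_relative'` with `Q := FarClean e m`. -/
def CleanCoreT (m : ℕ) [ConnectedSpace X] : Prop :=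
  ∀ (e : AFEnd X) (F : EuclideanSpace ℝ (Fin 1) → InitialDataSet (𝓡 3) X),
    InitialDataSet.IsTameDataFamily e 1 F →
      ((InitialDataSet.IsImmersedAtZero 1 F ∧ Injective F) ∨ ∀ c, F c = F 0) →
        (∀ c, F c ∈ admissibleVacuumData X) → (∀ c ≠ 0, FarClean X e m (F c)) →
          ∃ (e' : AFEnd X) (F' : EuclideanSpace ℝ (Fin 1) → InitialDataSet (𝓡 3) X),
            InitialDataSet.IsTameDataFamily e' 1 F' ∧ F' 0 = F 0 ∧ Injective F' ∧
              InitialDataSet.IsImmersedAtZero 1 F' ∧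
                (∀ c, F' c ∈ admissibleVacuumData X) ∧ ∀ c ≠ 0, PT (F' c)

end Broom

/-- **FIRST LEMMA of card `soft-brooms` (PROVED): `TameSoftBroom ∧ CleanCoreT ⇒ T`.**  Through an exceptional
datum pass the soft-broom curve and hand it to the clean core. -/
theorem T_of_softBroom_of_cleanCore (m : ℕ)
    (hB : ∀ (X : Type) [TopologicalSpace X] [ChartedSpace E3 X] [IsManifold (𝓡 3) ∞ X] [T2Space X]
      [SecondCountableTopology X] [ConnectedSpace X], TameSoftBroom X m)
    (hC : ∀ (X : Type) [TopologicalSpace X] [ChartedSpace E3 X] [IsManifold (𝓡 3) ∞ X] [T2Space X]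
      [SecondCountableTopology X] [ConnectedSpace X], CleanCoreT X m) : T := by
  intro X _ _ _ _ _ _ d hd
  obtain ⟨hd𝓓, -⟩ := hd
  obtain ⟨e, F, hF, himm, h0, hinj, h𝓓F, hclean⟩ := hB X d hd𝓓
  obtain ⟨e', F', hF', hF'0, hinj', himm', h𝓓F', hP⟩ := hC X e F hF (Or.inl ⟨himm, hinj⟩) h𝓓F hclean
  exact ⟨e', F', hF', himm', hF'0.trans h0, hinj', h𝓓F', fun c hc hmem ↦ hmem.2 (hP c hc)⟩

/-- … hence item 17575 BY NAME. -/
theorem crux_of_softBroom_of_cleanCore (m : ℕ)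
    (hB : ∀ (X : Type) [TopologicalSpace X] [ChartedSpace E3 X] [IsManifold (𝓡 3) ∞ X] [T2Space X]
      [SecondCountableTopology X] [ConnectedSpace X], TameSoftBroom X m)
    (hC : ∀ (X : Type) [TopologicalSpace X] [ChartedSpace E3 X] [IsManifold (𝓡 3) ∞ X] [T2Space X]
      [SecondCountableTopology X] [ConnectedSpace X], CleanCoreT X m) :
    Theses.StarvedNecks.HonestFixedRadiusSettlingT :=
  crux_of_T (T_of_softBroom_of_cleanCore m hB hC)

/-! ### §B Card `late-pair-kick`: the velocity conjunct as a relative cure over `T₀` -/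

section Kick

variable (X : Type) [TopologicalSpace X] [ChartedSpace E3 X] [IsManifold (𝓡 3) ∞ X] [ConnectedSpace X]

/-- **`ParabolicCure X`** (card `late-pair-kick`, the physics): every tame curve of admissible data whose members
off `0` satisfy `P_T₀` (honest fixed-radius settling, comoving pairs ALLOWED; the curve immersed-injective or
constant) can be re-witnessed through the same base datum by a tame, injective, immersed admissible curve whose
members off `0` satisfy `P_T` (pairwise distinct asymptotic velocities).  Intended construction: kick every member
`F c` by a late, symmetric, outgoing packet pair of energy `s(c) → 0` between each comoving pair (orbital energy
`E_∞ ↦ E_∞ + s > 0`: hyperbolic), then gauge-shear for immersion; `s(c)` is chosen below the (strong-topology)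
distance of `F c` to the `P_T₀`-bad set. Shape = `hrel` of `isTameChristodoulouGeneric_of_relative'` with `Q := PT0`. -/
def ParabolicCure : Prop :=
  ∀ (e : AFEnd X) (F : EuclideanSpace ℝ (Fin 1) → InitialDataSet (𝓡 3) X),
    InitialDataSet.IsTameDataFamily e 1 F →
      ((InitialDataSet.IsImmersedAtZero 1 F ∧ Injective F) ∨ ∀ c, F c = F 0) →
        (∀ c, F c ∈ admissibleVacuumData X) → (∀ c ≠ 0, PT0 (F c)) →
          ∃ (e' : AFEnd X) (F' : EuclideanSpace ℝ (Fin 1) → InitialDataSet (𝓡 3) X),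
            InitialDataSet.IsTameDataFamily e' 1 F' ∧ F' 0 = F 0 ∧ Injective F' ∧
              InitialDataSet.IsImmersedAtZero 1 F' ∧
                (∀ c, F' c ∈ admissibleVacuumData X) ∧ ∀ c ≠ 0, PT (F' c)

end Kick

/-- **FIRST LEMMA of card `late-pair-kick` (PROVED): `T₀ ∧ ParabolicCure ⇒ T`.**  Composition of tame
genericities along curves (`isTameChristodoulouGeneric_of_relative'`, landed): the velocity conjunct is paid
along `T₀`-curves, never by conjunction. -/
theorem T_of_T0_of_parabolicCure (h0 : T0)
    (hP : ∀ (X : Type) [TopologicalSpace X] [ChartedSpace E3 X] [IsManifold (𝓡 3) ∞ X] [T2Space X]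
      [SecondCountableTopology X] [ConnectedSpace X], ParabolicCure X) : T := by
  intro X _ _ _ _ _ _
  refine InitialDataSet.isTameChristodoulouGeneric_of_relative' ?_ (h0 X) (hP X)
  intro d hd
  exact exists_isSoleEnd_of_mem_admissibleVacuumData hd

/-- … hence item 17575 BY NAME. -/
theorem crux_of_T0_of_parabolicCure (h0 : T0)
    (hP : ∀ (X : Type) [TopologicalSpace X] [ChartedSpace E3 X] [IsManifold (𝓡 3) ∞ X] [T2Space X]
      [SecondCountableTopology X] [ConnectedSpace X], ParabolicCure X) :
    Theses.StarvedNecks.HonestFixedRadiusSettlingT :=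
  crux_of_T (T_of_T0_of_parabolicCure h0 hP)

/-! ### §C Card `no-hidden-infinity`: the rays clause split into a chart-free interior statement and coverage -/

section Rays

variable {X : Type} [TopologicalSpace X] [ChartedSpace E3 X] [IsManifold (𝓡 3) ∞ X] [ConnectedSpace X]
  {D : InitialDataSet (𝓡 3) X}

/-- An **escaping ray** of the Cauchy development `𝒟`: a future-COMPLETE normalised null ray `γ` from a point of the
data hypersurface whose chronological past (from parameter `0` on) meets `Σ` in a set with NON-compact closure —
it sees an unbounded part of the data, as the generators of `𝓘⁺` do and as a complete ray hidden behind a horizon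
(expanding region behind a trapped neck, BN-4-4) does not. Chart-free. -/
def IsEscapingRay (𝒟 : CauchyDevelopment D) [𝒟.metric.HasLeviCivita] (p : X) (γ : ℝ → 𝒟.carrier)
    (dom : Set ℝ) : Prop :=
  𝒟.metric.IsNormalisedNullRayFrom 𝒟.timeOrientation 𝒟.embed 𝒟.normal p γ dom ∧ ¬ BddAbove dom ∧
    ¬ IsCompact (closure
      (𝒟.embed ⁻¹' 𝒟.metric.chronologicalPast 𝒟.timeOrientation (γ '' (dom ∩ Ici 0))))

/-- The **intrinsic domain of outer communications** of `𝒟`: the chronological past of the escaping rays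
(a chart-free stand-in for `J⁻(𝓘⁺)`; no conformal boundary, no decomposition). -/
def docIntrinsic (𝒟 : CauchyDevelopment D) [𝒟.metric.HasLeviCivita] : Set 𝒟.carrier :=
  ⋃ (p : X) (γ : ℝ → 𝒟.carrier) (dom : Set ℝ) (_ : IsEscapingRay 𝒟 p γ dom),
    𝒟.metric.chronologicalPast 𝒟.timeOrientation (γ '' (dom ∩ Ici 0))

/-- **`NoHiddenInfinity 𝒟`** (card `no-hidden-infinity`, the INTERIOR statement hidden in `RaysStayInClosure`):
every future-complete normalised null ray from the data stays in the closure of the intrinsic domain of outer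
communications — equivalently, a null ray from `Σ` that enters the black-hole interior `M ∖ closure(DOC)` has
bounded affine domain ("black-hole interiors are totally future-null-incomplete along rays from `Σ`"; no hidden
expanding region). Mechanism: weak null singularities have `L¹` Christoffel symbols along transversal rays, hence
finite affine length (Luk arXiv:1311.4970; Dafermos–Luk, Ann. Math. 202 (2025); Luk–Sbierski arXiv:2604.04877). -/
def NoHiddenInfinity (𝒟 : CauchyDevelopment D) : Prop :=
  ∀ [𝒟.metric.HasLeviCivita], ∀ (p : X) (γ : ℝ → 𝒟.carrier) (dom : Set ℝ),
    𝒟.metric.IsNormalisedNullRayFrom 𝒟.timeOrientation 𝒟.embed 𝒟.normal p γ dom →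
      ¬ BddAbove dom → ∀ t ∈ dom, 0 ≤ t → γ t ∈ closure (docIntrinsic 𝒟)

/-- **Adapter (PROVED): `NoHiddenInfinity 𝒟` + coverage `DOC_intr ⊆ closure O` ⇒ `RaysStayInClosure 𝒟 O`.** -/
theorem raysStayInClosure_of_noHiddenInfinity (𝒟 : CauchyDevelopment D) (O : Set 𝒟.carrier)
    (h : NoHiddenInfinity 𝒟) (hcov : ∀ [𝒟.metric.HasLeviCivita], docIntrinsic 𝒟 ⊆ closure O) :
    RaysStayInClosure 𝒟 O := by
  intro inst p γ dom hγ hdom t ht h0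
  exact closure_minimal hcov isClosed_closure (h p γ dom hγ hdom t ht h0)

/-- `P_T^split`: `P_T` with the rays clause replaced by `NoHiddenInfinity 𝒟 ∧ (DOC_intr ⊆ closure O)`
(interior statement, chart-free and shareable across routes — plus coverage, exterior bookkeeping). -/
def PTsplit (D : InitialDataSet (𝓡 3) X) : Prop :=
  (∃ 𝒟 : VacuumCauchyDevelopment D, 𝒟.IsMaximal) ∧
    ∀ 𝒟 : VacuumCauchyDevelopment D, 𝒟.IsMaximal →
      HasCompleteNullInfinity 𝒟.toCauchyDevelopment ∧ NoHiddenInfinity 𝒟.toCauchyDevelopment ∧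
        ∃ (O : Set 𝒟.carrier) (d : FinalStateDecomposition 𝒟.toSpacetime O 4) (R₀ : ℝ),
          O = exteriorOf 𝒟.toCauchyDevelopment d.charted ∧
            (∀ [𝒟.toCauchyDevelopment.metric.HasLeviCivita],
              docIntrinsic 𝒟.toCauchyDevelopment ⊆ closure O) ∧
              HonestCore 𝒟.toSpacetime O 4 d R₀ ∧ HonestFar 𝒟.toSpacetime O 4 d R₀ ∧
                DistinctVelocities d

omit [ConnectedSpace X] in
/-- `P_T^split ⇒ P_T` pointwise (PROVED). -/
theorem pt_of_ptsplit [ConnectedSpace X] {D : InitialDataSet (𝓡 3) X} (h : PTsplit D) : PT D := by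
  refine ⟨h.1, fun 𝒟 h𝒟 ↦ ?_⟩
  obtain ⟨hscri, hint, O, d, R₀, hO, hcov, hc, hf, hdv⟩ := h.2 𝒟 h𝒟
  exact ⟨hscri, O, d, R₀, hO, raysStayInClosure_of_noHiddenInfinity _ O hint @hcov, hc, hf, hdv⟩

end Rays

/-- **T^split** — tame-generic `P_T^split`. -/
def Tsplit : Prop :=
  ∀ (X : Type) [TopologicalSpace X] [ChartedSpace E3 X] [IsManifold (𝓡 3) ∞ X] [T2Space X]
    [SecondCountableTopology X] [ConnectedSpace X],
    InitialDataSet.IsTameChristodoulouGeneric (admissibleVacuumData X) PTsplit 1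

/-- **FIRST LEMMA of card `no-hidden-infinity` (PROVED): `T^split ⇒ T`** (monotonicity of tame genericity). -/
theorem T_of_Tsplit (h : Tsplit) : T := fun X _ _ _ _ _ _ ↦ (h X).mono fun _ _ hP ↦ pt_of_ptsplit hP

/-- … hence item 17575 BY NAME. -/
theorem crux_of_Tsplit (h : Tsplit) : Theses.StarvedNecks.HonestFixedRadiusSettlingT :=
  crux_of_T (T_of_Tsplit h)

end Summit.FinalStateConjecture.FinalStateConjecture.Cruxes.HonestFixedRadiusSettlingT.Ideator1

end
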